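import Summits.BirchSwinnertonDyer.BirchSwinnertonDyer.Theses.GenusKolyvaginAtTwo

/-!
# Route `GenusKolyvaginAtTwo`, crux #3 `KolyvaginExactAtTwo` (stmt-BirchSwinnertonDyer-22137):
# descent of invariant classes to an overgroup when there are no invariants — the surjectivity
# half of memo v4 §9.1, as an explicit cocycle construction (helper, PROVED; seat
# `bsd-line-gk2-p2`, line `birth`, third helper file)

Memo ANALYSIS-22137 v4 §9 (evidence on the item) moves Kolyvagin's structure argument at `p = 2`
from `K` to `ℚ`: since `E(K)[2] = 0`, restriction identifies `H¹(ℚ, E[2^M])` with the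
`τ`-invariant classes of `H¹(K, E[2^M])` and `H¹(ℚ, E^{(d_K)}[2^M])` with the `τ`-anti-invariant
ones, and every derived class `c_M(n)` — a `τ`-eigenvector — descends to the member of its sign of
the pair `(E, E^{(d_K)})`. The second helper file proved the INJECTIVITY of restriction
(`GenusExact.res_H1_injective_of_forall_invariant_eq_zero`, via Mathlib's `H1InfRes`). This file
proves the SURJECTIVITY onto invariant classes, in the concrete language of `1`-cocycles, for any
group `G` acting on an additive group `A` (`DistribMulAction`), any normal subgroup `S` with
`A^S = 0`:

* `eq_of_forall_smul_sub_eq` — **rigidity**: an element `a` with `s • a - a` prescribed for all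
  `s ∈ S` is unique (two solutions differ by an `S`-invariant, i.e. by `0`).
* `smul_apply_conj_of_cocycle` — a `1`-cocycle `y` on `G` automatically satisfies
  `g • y (g⁻¹ s g) = y s + (s • y g - y g)`: its own values witness the invariance of its class.
* `exists_cocycle_extension` — for a function `x : G → A` which is a `1`-cocycle ON `S` and whose
  class is `G`-INVARIANT in the concrete sense `∀ g, ∃ a, ∀ s ∈ S, g • x (g⁻¹ s g) = x s + (s • a - a)`
  (the conjugate cocycle `g·x` is cohomologous to `x`), the witnesses `a_g` are unique, `a_s = x s`
  on `S`, and `g ↦ a_g` is a `1`-cocycle on ALL of `G` extending `x`. With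
  `cocycle_extension_unique` (two cocycles on `G` agreeing on `S` are equal — not merely
  cohomologous): **restriction is a bijection from `1`-cocycles on `G` onto `G`-invariant
  `1`-cocycle classes on `S`, at the level of cocycles, whenever `A^S = 0`.**

With `G = Gal(M/ℚ) ⊇ S = Gal(M/K)` of index `2` (`M ⊇ K(E[2^M])` Galois over `ℚ`), `A = E[2^M]`
(resp. `E^{(d_K)}[2^M] = E[2^M] ⊗ χ_K`), `A^S = E(K)[2^M] = 0`: a class in `H¹(K, E[2^M])` fixed by
`τ` (resp. with `τ c = −c`) is the restriction of a unique class over `ℚ` on `E` (resp. on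
`E^{(d_K)}`). At odd `p` this is the eigenspace decomposition; at `p = 2` it is what replaces it
(the two images still generate only an index-`2^k` subgroup and meet in `H¹(K, E[2^M])[2]^τ`). Pure
group theory; BSD is not proved by any of this.

References: [Kolyvagin1989Izv] §3 (the classes are built over `ℚ` on `A ∈ {E, E^D}`);
[GrossLMS1991] Prop. 5.4 (`τ c(n) = ε_n c(n)`); Serre, *Local Fields* VII §6 (inflation–restriction).
-/

set_option linter.dupNamespace false

namespace Summit.BirchSwinnertonDyer.BirchSwinnertonDyer.Theorems.GenusExact

section Descent2

variable {G : Type*} [Group G] {A : Type*} [AddCommGroup A] [DistribMulAction G A]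
  (S : Subgroup G)

/-- **Rigidity under `A^S = 0`.** If `S` has no non-zero invariants in `A` and
`s • a - a = s • b - b` for all `s ∈ S`, then `a = b`. [folklore] -/
theorem eq_of_forall_smul_sub_eq (hS : ∀ a : A, (∀ s ∈ S, s • a = a) → a = 0) {a b : A}
    (h : ∀ s ∈ S, s • a - a = s • b - b) : a = b := by
  have hab : a - b = 0 := hS (a - b) fun s hs ↦ by
    rw [smul_sub]
    exact sub_eq_sub_iff_sub_eq_sub.mp (h s hs)
  exact sub_eq_zero.mp hab

/-- A `1`-cocycle `y : G → A` (`y (g h) = y g + g • y h`) satisfies, for all `g, s`,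
`g • y (g⁻¹ s g) = y s + (s • y g - y g)`: the conjugate cocycle `g·y` differs from `y` by the
coboundary of `y g`. [folklore] -/
theorem smul_apply_conj_of_cocycle (y : G → A) (hy : ∀ g h : G, y (g * h) = y g + g • y h)
    (g s : G) : g • y (g⁻¹ * s * g) = y s + (s • y g - y g) := by
  have h1 : y (g * (g⁻¹ * s * g)) = y g + g • y (g⁻¹ * s * g) := hy g _
  have h2 : y (s * g) = y s + s • y g := hy s g
  have e : g * (g⁻¹ * s * g) = s * g := by group
  rw [e, h2] at h1
  -- h1 : y s + s • y g = y g + g • y (g⁻¹ * s * g)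
  have := (eq_sub_of_add_eq' h1.symm)
  -- this : g • y (g⁻¹ * s * g) = y s + s • y g - y g
  rw [this]
  abel

/-- **Uniqueness of the extension.** Under `A^S = 0`, two `1`-cocycles on `G` that agree on `S`
are EQUAL (as functions). [folklore] -/
theorem cocycle_extension_unique [S.Normal] (hS : ∀ a : A, (∀ s ∈ S, s • a = a) → a = 0)
    (y y' : G → A)
    (hy : ∀ g h : G, y (g * h) = y g + g • y h) (hy' : ∀ g h : G, y' (g * h) = y' g + g • y' h)
    (hyy' : ∀ s ∈ S, y s = y' s) : y = y' := by
  funext g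
  refine eq_of_forall_smul_sub_eq S hS fun s hs ↦ ?_
  have h1 := smul_apply_conj_of_cocycle y hy g s
  have h2 := smul_apply_conj_of_cocycle y' hy' g s
  -- both equal `g • y (g⁻¹ s g) - y s` with `y = y'` on `S`
  have hsg : g⁻¹ * s * g ∈ S := Subgroup.Normal.conj_mem' inferInstance s hs g
  rw [hyy' _ hsg, hyy' s hs, h2] at h1
  exact (add_right_injective (y' s) h1).symm

variable [S.Normal]

/-- **Descent of invariant classes (existence).** Let `S ⊴ G` with `A^S = 0`, and let `x : G → A`
be a `1`-cocycle on `S` whose class is `G`-invariant: for every `g` some `a` satisfies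
`g • x (g⁻¹ s g) = x s + (s • a - a)` for all `s ∈ S`. Then `x|_S` extends to a `1`-cocycle on `G`
(unique by `cocycle_extension_unique`). Construction: `y g :=` the (unique) witness `a_g`; then
`a_s = x s` for `s ∈ S` and `a_{gh} = a_g + g • a_h`, both by rigidity. (Use: `G ↠ Gal(K(E[2^M])/ℚ)`,
`S` the index-`2` subgroup fixing `K`, `A = E[2^M]` or its twist by `χ_K`: `τ`-(anti-)invariant
classes over `K` come from `ℚ`.) [folklore] -/
theorem exists_cocycle_extension (hS : ∀ a : A, (∀ s ∈ S, s • a = a) → a = 0) (x : G → A)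
    (hx : ∀ s ∈ S, ∀ t ∈ S, x (s * t) = x s + s • x t)
    (hinv : ∀ g : G, ∃ a : A, ∀ s ∈ S, g • x (g⁻¹ * s * g) = x s + (s • a - a)) :
    ∃ y : G → A, (∀ g h : G, y (g * h) = y g + g • y h) ∧ ∀ s ∈ S, y s = x s := by
  choose a ha using hinv
  refine ⟨a, fun g h ↦ ?_, fun s hs ↦ ?_⟩
  · -- `a (g * h) = a g + g • a h`, by rigidity
    refine eq_of_forall_smul_sub_eq S hS fun s hs ↦ ?_
    have hsg : g⁻¹ * s * g ∈ S := Subgroup.Normal.conj_mem' inferInstance s hs g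
    have h1 := ha (g * h) s hs
    have h2 := ha h (g⁻¹ * s * g) hsg
    have h3 := ha g s hs
    have e1 : (g * h)⁻¹ * s * (g * h) = h⁻¹ * (g⁻¹ * s * g) * h := by group
    have e2 : g * (g⁻¹ * s * g) = s * g := by group
    rw [e1, mul_smul, h2, smul_add, h3, smul_sub, ← mul_smul, e2, mul_smul] at h1
    -- h1 : x s + (s • a g - a g) + (s • g • a h - g • a h) = x s + (s • a (g * h) - a (g * h))
    rw [add_assoc] at h1
    have h4 := add_right_injective (x s) h1
    -- h4 : s • a g - a g + (s • g • a h - g • a h) = s • a (g * h) - a (g * h)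
    rw [← h4, smul_add]
    abel
  · -- `a s = x s` for `s ∈ S`, by rigidity
    refine eq_of_forall_smul_sub_eq S hS fun t ht ↦ ?_
    have hst : s⁻¹ * t * s ∈ S := Subgroup.Normal.conj_mem' inferInstance t ht s
    have h1 := ha s t ht
    -- `s • x (s⁻¹ t s) = x (t s) - x s = x t + t • x s - x s`
    have e1 : x (t * s) = x s + s • x (s⁻¹ * t * s) := by
      have := hx s hs (s⁻¹ * t * s) hst
      rwa [show s * (s⁻¹ * t * s) = t * s by group] at this
    have e2 : x (t * s) = x t + t • x s := hx t ht s hs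
    have e3 : s • x (s⁻¹ * t * s) = x t + (t • x s - x s) := by
      have := (eq_sub_of_add_eq' e1.symm)
      rw [this, e2]
      abel
    rw [e3] at h1
    exact (add_right_injective (x t) h1).symm

end Descent2

end Summit.BirchSwinnertonDyer.BirchSwinnertonDyer.Theorems.GenusExact
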